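/-
Copyright (c) 2026 the pub-hodgecm-mathlib formalisation cell (harness21).  Prover seat hodgecm-mathlib-K2E3-p03 (g7), HCML Track B «K2-LIT»,
h413 = `stmt-HodgeConjecture-24833`, road (11-3-split-nsc), leaf (nsc-S-A′), brick S2 (PEEL-LINKED, dealer D102; consumer K2E3-p17 (g8)'s S4, C1′∕C1″∕C2): the
Frobenius peeling step at a LINKED exponent `(ην^{-1∕2} ⊠ ην^{1∕2}) ⊗ ξ` whose swap does not occur.  2026-09-04.
-/
import Summits.HodgeConjecture.HodgeConjecture.Theorems.K2E3GL2JacquetPeelingStep    -- ★ PEEL (K2E3-p25): template, and ★ PEEL file 1 `exists_prodRep` ∕ `prodRep_apply_mk` ∕ `exact_of_mk_comp`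
import Summits.HodgeConjecture.HodgeConjecture.Theorems.K2E3GL2LinkedJacquetRank     -- ★ S1c (K2E3-p17): `finrank_jacquet_lastBlockLabel_eq_one_of_ne_bot_of_ne_top`, `eq_range_of_le_mult`; brings ★ S1b, ★ REG
import Summits.HodgeConjecture.HodgeConjecture.Theorems.K2E3GL3PeelLinkedPrep        -- (this seat) `exists_ker_range_package`, `forall_apply_eq_smul_of_finrank_eq_one`, `nonempty_equiv_range_of_injective`
import Literature.NumberTheory.Automorphic.AdmissibleSubquotient                     -- ★ `Representation.IsSmooth.toRepresentation`
import HarnessLib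

/-!
# K2_E3 road (h413), leaf (nsc-S-A′), brick S2 — THE LINKED PEELING STEP: peeling the character `η∘det` off a `GL₂(F)`-representation with commuting action at the
# exponent `(ην^{-1∕2} ⊠ ην^{1∕2}) ⊗ ξ` when the swapped exponent does not occur

Cell `pub/hodgecm-mathlib` (D-0151), Track B, seat K2E3-p03 (g7) (dealer K2E3-plan (g4) D102, spec K2E3-p17 (g8) K2 bus 2026-09-04 11:41Z ∕ 12:32Z).
`--supports stmt-HodgeConjecture-24833 --as helper`; THEOREMS ONLY (no `def`, no instance, no notation, no named fact, no `sorry`); never imports `Cruxes/…/Lines`.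
COUNT-NEUTRAL.  Setting and currency = ★ PEEL `K2E3GL2JacquetPeelingStep.exists_peel` TOKEN FOR TOKEN (`W`, `ζ`, `τ`, `hτ₁`, `hτ₂`, weights `(x ⊠ y) ⊗ ξ := fun p =>
(x ⊠ y) p.1 * ξ p.2`, `mult τ χ := finrank ℂ ↥(⨅ p, maxGenEigenspace (τ p) (χ p))`), with `a := ην^{-1∕2}`, `b := ην^{1∕2}` spelled as in ★ S1b∕S1c.

THE RESULT **`exists_peel_linked`** ([BernsteinZelevinsky1977, Prop. 1.9, §2.3, Cor. 2.13, Thm. 2.5; Zelevinsky1980, Prop. 2.10, Ex. 3.2; Casselman1995, §6.3, Prop. 7.1.3]):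
if `C(X)` is finite-dimensional, the weight `(a ⊠ b) ⊗ ξ` OCCURS in `τ` and the swapped weight `(b ⊠ a) ⊗ ξ` does NOT, there is a `W`- and `ζ`-stable `K ≤ X` (kernel of the
Frobenius map `Φ : X → I₂(a,b)` of a `τ`-eigenfunctional) with `W|_K` smooth, `C(K)` finite-dimensional, **`dim C(K) + 1 = dim C(X)`**, **`mult_X ((a⊠b)⊗ξ) = mult_K ((a⊠b)⊗ξ) + 1`**,
**all other weights (as functions on `T₂ × D`) untouched**, and **`X ⁄ K ≅ η∘det`**.  Proof: steps (1)–(2) of ★ PEEL; `Φ` is NOT surjective (else `C(X) ↠ C(I₂(a,b))` forces the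
weight `(b⊠a)⊗ξ`: ★ G1 (a) with `a ≠ b` ★ REG, ★ E1a); so `N := im Φ` is a PROPER NON-ZERO subrepresentation of `I₂(a,b)`, `dim C(N) = 1` (★ S1c), and `T₂ × D` acts on the line
`C(N)` by `(a⊠b)⊗ξ` — pinned by the non-zero eigenfunctional `E ∘ j_{N ↪ I₂}` (★ G1 `evalOne`; prep); Jacquet exactness of `0 → K → X → N → 0` (★ PEEL (3)) + ★ E1a give
the counts; `X ⁄ K ≅ N` (prep) and `N = η∘det` (★ S1c `eq_range_of_le_mult`, ★ S1b) give the quotient.  PERF as ★ PEEL (no generic `rw` on `normalizedJacquetGL … [v]` goals,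
`have …; obtain … := this`, one raised CUMULATIVE heartbeat budget — no single expensive step).

HONEST LABEL: HC_CM is proved only modulo the 7 printed citations (2 remaining named inputs: hLiu418 = stmt-HodgeConjecture-24832, h413 = stmt-HodgeConjecture-24833) until rung 0
closes; count-neutral helper.

## References
* [BernsteinZelevinsky1977] I. N. Bernstein, A. V. Zelevinsky, *Induced representations of reductive p-adic groups I*, Ann. Sci. ÉNS 10 (1977), Prop. 1.9, §2.3, Cor. 2.13, Thm. 2.5.
* [Zelevinsky1980] A. V. Zelevinsky, *Induced representations of reductive p-adic groups II*, Ann. Sci. ÉNS 13 (1980), Prop. 2.10, Ex. 3.2.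
* [Casselman1995] W. Casselman, *Introduction to the theory of admissible representations of p-adic reductive groups* (draft 1 May 1995), §4.4, §6.3, Prop. 7.1.3.
-/

set_option autoImplicit false
set_option linter.dupNamespace false

noncomputable section

open Module Module.End Function
open scoped MatrixGroups
open Literature.NumberTheory.Automorphic Literature.NumberTheory.Automorphic.Zelevinsky1980 ValuativeRel
open Literature.NumberTheory.GaloisRepresentations Literature.NumberTheory.GaloisRepresentations.IsNonarchimedeanLocalField
open Summit.HodgeConjecture.HodgeConjecture.Cruxes.H413.K2E3GL2JacquetModuleStructure
open Summit.HodgeConjecture.HodgeConjecture.Cruxes.H413.K2E3GL2JacquetExponents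
open Summit.HodgeConjecture.HodgeConjecture.Cruxes.H413.K2E3JacquetExponentMultiset
open Summit.HodgeConjecture.HodgeConjecture.Cruxes.H413.K2E3JacquetExponentEigenvector
open Summit.HodgeConjecture.HodgeConjecture.Cruxes.H413.K2E3GL2JacquetProdRep
open Summit.HodgeConjecture.HodgeConjecture.Cruxes.H413.K2E3GL3PeelLinkedPrep

namespace Summit.HodgeConjecture.HodgeConjecture.Cruxes.H413.K2E3GL3PeelLinked

/-! ## The linked peeling step -/

section Peel

variable {F : Type} [Field F] [ValuativeRel F] [TopologicalSpace F] [IsNonarchimedeanLocalField F]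
variable {D : Type} [Group D]
variable {X : Type} [AddCommGroup X] [Module ℂ X]

set_option maxHeartbeats 6000000 in  -- one long bookkeeping proof over large `normalizedJacquetGL` terms (cumulative budget, no single expensive step), as ★ PEEL
/-- **THE LINKED PEELING STEP.**  Binders of ★ `exists_peel` (`W` smooth with finite-dimensional `U₂`-coinvariants, commuting `D`-action `ζ`, the `T₂ × D`-action `τ`); `η` with open
kernel, `a := ην^{-1∕2}`, `b := ην^{1∕2}`, `ξ : D → ℂ`.  If the weight `(a ⊠ b) ⊗ ξ` OCCURS in `τ` (`hne`) and `(b ⊠ a) ⊗ ξ` does NOT (`hno`), there are a `W`- and `ζ`-stable `K ≤ X`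
(kernel of the Frobenius map `X → I₂(a,b)`, whose image is `η∘det`), `ζ_K`, `τ_K` (the five structure clauses of ★ `exists_peel`), with `C(K)` finite-dimensional,
**`finrank C(K) + 1 = finrank C(X)`**, **`mult τ ((a⊠b)⊗ξ) = mult τ_K ((a⊠b)⊗ξ) + 1`**, **`mult τ χ′ = mult τ_K χ′` for every other weight function `χ′`**, and **`X ⁄ K ≅ η ∘ det`**.
[cite: BernsteinZelevinsky1977, Prop. 1.9 (b), Cor. 2.13, Thm. 2.5] [cite: Zelevinsky1980, Prop. 2.10, Ex. 3.2] [cite: Casselman1995, §6.3, Prop. 7.1.3] -/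
theorem exists_peel_linked (hD : ∀ d d' : D, d * d' = d' * d)
    (W : Representation ℂ (GL (Fin 2) F) X) (hW : W.IsSmooth) (ζ : Representation ℂ D X) (hWζ : ∀ g d, W g * ζ d = ζ d * W g)
    (τ : Representation ℂ ((Π a : Bool, GL {i : Fin 2 // lastBlockLabel 2 i = a} F) × D) (Representation.restrictUnipotentGL F (lastBlockLabel 2) W).Coinvariants)
    (hτ₁ : ∀ t, τ (t, 1) = Representation.normalizedJacquetGL F (lastBlockLabel 2) W t)
    (hτ₂ : ∀ d v, τ (1, d) (Representation.Coinvariants.mk _ v) = Representation.Coinvariants.mk _ (ζ d v))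
    [FiniteDimensional ℂ (Representation.restrictUnipotentGL F (lastBlockLabel 2) W).Coinvariants]
    (η : Fˣ →* ℂˣ) (hη : IsOpen ((η.ker : Subgroup Fˣ) : Set Fˣ)) (ξ : D → ℂ)
    (hne : (⨅ p, Module.End.maxGenEigenspace (τ p) (((maxParabolicLeviChar F 2 (η * ((unramifiedTwist F (1 / 2) : QuasiChar F).toMonoidHom)⁻¹) (η * ((unramifiedTwist F (1 / 2) : QuasiChar F).toMonoidHom)) p.1 : ℂˣ) : ℂ) * ξ p.2)) ≠ ⊥)
    (hno : (⨅ p, Module.End.maxGenEigenspace (τ p) (((maxParabolicLeviChar F 2 (η * ((unramifiedTwist F (1 / 2) : QuasiChar F).toMonoidHom)) (η * ((unramifiedTwist F (1 / 2) : QuasiChar F).toMonoidHom)⁻¹) p.1 : ℂˣ) : ℂ) * ξ p.2)) = ⊥) :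
    ∃ (K : Subrepresentation W) (ζK : Representation ℂ D K.toSubmodule)
      (τK : Representation ℂ ((Π a : Bool, GL {i : Fin 2 // lastBlockLabel 2 i = a} F) × D) (Representation.restrictUnipotentGL F (lastBlockLabel 2) K.toRepresentation).Coinvariants),
      (∀ d (v : K.toSubmodule), ((ζK d v : K.toSubmodule) : X) = ζ d (v : X)) ∧
      (∀ g d, K.toRepresentation g * ζK d = ζK d * K.toRepresentation g) ∧
      K.toRepresentation.IsSmooth ∧
      (∀ t, τK (t, 1) = Representation.normalizedJacquetGL F (lastBlockLabel 2) K.toRepresentation t) ∧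
      (∀ d v, τK (1, d) (Representation.Coinvariants.mk _ v) = Representation.Coinvariants.mk _ (ζK d v)) ∧
      FiniteDimensional ℂ (Representation.restrictUnipotentGL F (lastBlockLabel 2) K.toRepresentation).Coinvariants ∧
      finrank ℂ (Representation.restrictUnipotentGL F (lastBlockLabel 2) K.toRepresentation).Coinvariants + 1 = finrank ℂ (Representation.restrictUnipotentGL F (lastBlockLabel 2) W).Coinvariants ∧
      finrank ℂ ↥(⨅ p, Module.End.maxGenEigenspace (τ p) (((maxParabolicLeviChar F 2 (η * ((unramifiedTwist F (1 / 2) : QuasiChar F).toMonoidHom)⁻¹) (η * ((unramifiedTwist F (1 / 2) : QuasiChar F).toMonoidHom)) p.1 : ℂˣ) : ℂ) * ξ p.2)) = finrank ℂ ↥(⨅ p, Module.End.maxGenEigenspace (τK p) (((maxParabolicLeviChar F 2 (η * ((unramifiedTwist F (1 / 2) : QuasiChar F).toMonoidHom)⁻¹) (η * ((unramifiedTwist F (1 / 2) : QuasiChar F).toMonoidHom)) p.1 : ℂˣ) : ℂ) * ξ p.2)) + 1 ∧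
      (∀ χ' : ((Π a : Bool, GL {i : Fin 2 // lastBlockLabel 2 i = a} F) × D) → ℂ, χ' ≠ (fun p => (((maxParabolicLeviChar F 2 (η * ((unramifiedTwist F (1 / 2) : QuasiChar F).toMonoidHom)⁻¹) (η * ((unramifiedTwist F (1 / 2) : QuasiChar F).toMonoidHom)) p.1 : ℂˣ) : ℂ) * ξ p.2)) →
        finrank ℂ ↥(⨅ p, Module.End.maxGenEigenspace (τ p) (χ' p)) = finrank ℂ ↥(⨅ p, Module.End.maxGenEigenspace (τK p) (χ' p))) ∧
      Nonempty (K.quotientRep.Equiv ((Representation.trivial ℂ (GL (Fin 2) F) ℂ).twist (η.comp (Matrix.GeneralLinearGroup.det : GL (Fin 2) F →* Fˣ)))) := by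
  classical
  -- (0) `a`, `b` have open kernels and are distinct
  have ha : IsOpen (((η * ((unramifiedTwist F (1 / 2) : QuasiChar F).toMonoidHom)⁻¹).ker : Subgroup Fˣ) : Set Fˣ) :=
    K2E3GL3StandardModuleEmbedding.isOpen_ker_mul_of_isOpen hη
      (by rw [K2E3GL3StandardModuleEmbedding.ker_inv_eq_ker]; exact K2E3GL3StandardModuleEmbedding.isOpen_ker_nuHalf)
  have hb : IsOpen (((η * ((unramifiedTwist F (1 / 2) : QuasiChar F).toMonoidHom)).ker : Subgroup Fˣ) : Set Fˣ) :=
    K2E3GL3StandardModuleEmbedding.isOpen_ker_mul_of_isOpen hη K2E3GL3StandardModuleEmbedding.isOpen_ker_nuHalf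
  have hab : (η * ((unramifiedTwist F (1 / 2) : QuasiChar F).toMonoidHom)⁻¹) ≠ (η * ((unramifiedTwist F (1 / 2) : QuasiChar F).toMonoidHom)) := K2E3GL3PrincipalSeriesRegular.mul_nuHalf_inv_ne_mul_nuHalf η
  -- (1) a non-zero `T₂ × D`-eigenfunctional of eigencharacter `(a ⊠ b) ⊗ ξ` (★ PEEL (1) verbatim)
  have hl' := exists_functional_of_weightSpace_ne_bot τ (commute_prodRep hD τ)
    (fun p => (((maxParabolicLeviChar F 2 (η * ((unramifiedTwist F (1 / 2) : QuasiChar F).toMonoidHom)⁻¹) (η * ((unramifiedTwist F (1 / 2) : QuasiChar F).toMonoidHom)) p.1 : ℂˣ) : ℂ) * ξ p.2)) hne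
  obtain ⟨l, hl0, hl⟩ := hl'
  obtain ⟨v₀, hz₀⟩ : ∃ v, l (Representation.Coinvariants.mk (Representation.restrictUnipotentGL F (lastBlockLabel 2) W) v) ≠ 0 := by
    by_contra h
    push Not at h
    exact hl0 (Representation.Coinvariants.hom_ext (LinearMap.ext fun v => by rw [LinearMap.comp_apply, h v]; rfl))
  have hlD : ∀ d z, l (τ (1, d) z) = ξ d * l z := by
    intro d z
    have h := hl (1, d) z
    simp only [map_one, Units.val_one, one_mul] at h
    exact h
  have hξ1 : ξ 1 = 1 := by
    have h := hlD 1 (Representation.Coinvariants.mk (Representation.restrictUnipotentGL F (lastBlockLabel 2) W) v₀)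
    rw [Prod.mk_one_one, map_one, Module.End.one_apply] at h
    exact (mul_eq_right₀ hz₀).1 h.symm
  have hξmul : ∀ d d', ξ (d * d') = ξ d * ξ d' := by
    intro d d'
    have h := hlD (d * d') (Representation.Coinvariants.mk (Representation.restrictUnipotentGL F (lastBlockLabel 2) W) v₀)
    have h2 : τ ((1 : (Π a : Bool, GL {i : Fin 2 // lastBlockLabel 2 i = a} F)), d * d') (Representation.Coinvariants.mk (Representation.restrictUnipotentGL F (lastBlockLabel 2) W) v₀) =
        τ ((1 : (Π a : Bool, GL {i : Fin 2 // lastBlockLabel 2 i = a} F)), d) (τ ((1 : (Π a : Bool, GL {i : Fin 2 // lastBlockLabel 2 i = a} F)), d') (Representation.Coinvariants.mk (Representation.restrictUnipotentGL F (lastBlockLabel 2) W) v₀)) := by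
      rw [← Module.End.mul_apply, ← map_mul, Prod.mk_mul_mk, one_mul]
    rw [h2, hlD, hlD, ← mul_assoc] at h
    exact (mul_left_injective₀ hz₀ h).symm
  have hξ0 : ∀ d, ξ d ≠ 0 := by
    intro d h
    have h1 := hξmul d d⁻¹
    rw [mul_inv_cancel, hξ1, h, zero_mul] at h1
    exact one_ne_zero h1
  -- (2) the `T₂`-map `r(W) → a ⊠ b` and the Frobenius map `Φ : W → I₂(a,b)` (★ PEEL (2) verbatim)
  have hlT : ∀ t z, l (Representation.normalizedJacquetGL F (lastBlockLabel 2) W t z) = ((maxParabolicLeviChar F 2 (η * ((unramifiedTwist F (1 / 2) : QuasiChar F).toMonoidHom)⁻¹) (η * ((unramifiedTwist F (1 / 2) : QuasiChar F).toMonoidHom)) t : ℂˣ) : ℂ) * l z := by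
    intro t z
    have h := hl (t, 1) z
    rw [hτ₁, hξ1, mul_one] at h
    exact h
  let ψ : (Representation.normalizedJacquetGL F (lastBlockLabel 2) W).IntertwiningMap
      ((Representation.trivial ℂ (Π a : Bool, GL {i : Fin 2 // lastBlockLabel 2 i = a} F) ℂ).twist (maxParabolicLeviChar F 2 (η * ((unramifiedTwist F (1 / 2) : QuasiChar F).toMonoidHom)⁻¹) (η * ((unramifiedTwist F (1 / 2) : QuasiChar F).toMonoidHom)))) :=
    ⟨l, fun t => LinearMap.ext fun z => by
      rw [LinearMap.comp_apply, LinearMap.comp_apply, Representation.twist_apply, Representation.trivial_apply, smul_eq_mul]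
      exact hlT t z⟩
  have hΦ' : ∃ Φ : W.IntertwiningMap (Representation.parabolicIndGL F (lastBlockLabel 2) ((Representation.trivial ℂ (Π a : Bool, GL {i : Fin 2 // lastBlockLabel 2 i = a} F) ℂ).twist (maxParabolicLeviChar F 2 (η * ((unramifiedTwist F (1 / 2) : QuasiChar F).toMonoidHom)⁻¹) (η * ((unramifiedTwist F (1 / 2) : QuasiChar F).toMonoidHom))))),
      ∀ v g, (Φ v).toFun g = l (Representation.Coinvariants.mk (Representation.restrictUnipotentGL F (lastBlockLabel 2) W) (W g v)) := by
    refine ⟨Representation.frobeniusInv hW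
      { toLinearMap := ψ.toLinearMap ∘ₗ Representation.Coinvariants.mk (Representation.restrictUnipotentGL F (lastBlockLabel 2) W)
        isIntertwining' := fun q => LinearMap.ext fun v => by
          simp only [LinearMap.coe_comp, Function.comp_apply, Representation.IntertwiningMap.coe_toLinearMap]
          rw [Representation.twist_apply, MonoidHom.comp_apply, MonoidHom.comp_apply]
          exact apply_mk_apply_of_intertwining ψ q v }, fun v g => rfl⟩
  obtain ⟨Φ, hΦ⟩ := hΦ'
  have hΦ1 : (Φ v₀).toFun 1 = l (Representation.Coinvariants.mk (Representation.restrictUnipotentGL F (lastBlockLabel 2) W) v₀) := by rw [hΦ, W.map_one, Module.End.one_apply]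
  have hΦv₀ : Φ v₀ ≠ 0 := by
    intro h
    have h2 : Φ v₀ = (0 : ℂ) • Φ v₀ := by rw [h, smul_zero]
    have h1 : (Φ v₀).toFun 1 = 0 := by
      rw [h2, Representation.SmoothInd.toFun_smul, Pi.smul_apply, smul_eq_mul, zero_mul]
    exact hz₀ (hΦ1.symm.trans h1)
  have hΦD : ∀ d v, Φ (ζ d v) = ξ d • Φ v := by
    intro d v
    refine Representation.SmoothInd.ext (funext fun g => ?_)
    rw [Representation.SmoothInd.toFun_smul, Pi.smul_apply, hΦ, hΦ, smul_eq_mul, ← Module.End.mul_apply, hWζ, Module.End.mul_apply, ← hτ₂, hlD]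
  have hΦG : ∀ g v, Φ (W g v) = (Representation.parabolicIndGL F (lastBlockLabel 2) ((Representation.trivial ℂ (Π a : Bool, GL {i : Fin 2 // lastBlockLabel 2 i = a} F) ℂ).twist (maxParabolicLeviChar F 2 (η * ((unramifiedTwist F (1 / 2) : QuasiChar F).toMonoidHom)⁻¹) (η * ((unramifiedTwist F (1 / 2) : QuasiChar F).toMonoidHom))))) g (Φ v) :=
    fun g v => Φ.isIntertwining _ _ g v
  -- the target `I₂(a,b)`: smooth, `C(I₂)` finite-dimensional, its `T₂ × D`-module `ξ(d) • r(t)`, the Jacquet map of `Φ` (★ PEEL (4))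
  have hIsm : (Representation.parabolicIndGL F (lastBlockLabel 2) ((Representation.trivial ℂ (Π a : Bool, GL {i : Fin 2 // lastBlockLabel 2 i = a} F) ℂ).twist (maxParabolicLeviChar F 2 (η * ((unramifiedTwist F (1 / 2) : QuasiChar F).toMonoidHom)⁻¹) (η * ((unramifiedTwist F (1 / 2) : QuasiChar F).toMonoidHom))))).IsSmooth := by
    rw [parabolicIndGL_two_eq_smoothIndRep]; exact Representation.isSmooth_smoothInd _ _
  haveI hIfd := finiteDimensional_jacquet_parabolicIndGL (η * ((unramifiedTwist F (1 / 2) : QuasiChar F).toMonoidHom)⁻¹) (η * ((unramifiedTwist F (1 / 2) : QuasiChar F).toMonoidHom)) ha hb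
  have hjΦ' := exists_jacquetLinearMap W (Representation.parabolicIndGL F (lastBlockLabel 2) ((Representation.trivial ℂ (Π a : Bool, GL {i : Fin 2 // lastBlockLabel 2 i = a} F) ℂ).twist (maxParabolicLeviChar F 2 (η * ((unramifiedTwist F (1 / 2) : QuasiChar F).toMonoidHom)⁻¹) (η * ((unramifiedTwist F (1 / 2) : QuasiChar F).toMonoidHom))))) hIsm Φ
  obtain ⟨jΦ, hjΦ_mk, _hjΦ_J, _hjΦ_inj, hjΦ_surj⟩ := hjΦ'
  have hτ₃' : ∃ τ₃ : Representation ℂ ((Π a : Bool, GL {i : Fin 2 // lastBlockLabel 2 i = a} F) × D) (Representation.restrictUnipotentGL F (lastBlockLabel 2) (Representation.parabolicIndGL F (lastBlockLabel 2) ((Representation.trivial ℂ (Π a : Bool, GL {i : Fin 2 // lastBlockLabel 2 i = a} F) ℂ).twist (maxParabolicLeviChar F 2 (η * ((unramifiedTwist F (1 / 2) : QuasiChar F).toMonoidHom)⁻¹) (η * ((unramifiedTwist F (1 / 2) : QuasiChar F).toMonoidHom)))))).Coinvariants,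
      ∀ p, τ₃ p = ξ p.2 • Representation.normalizedJacquetGL F (lastBlockLabel 2) (Representation.parabolicIndGL F (lastBlockLabel 2) ((Representation.trivial ℂ (Π a : Bool, GL {i : Fin 2 // lastBlockLabel 2 i = a} F) ℂ).twist (maxParabolicLeviChar F 2 (η * ((unramifiedTwist F (1 / 2) : QuasiChar F).toMonoidHom)⁻¹) (η * ((unramifiedTwist F (1 / 2) : QuasiChar F).toMonoidHom))))) p.1 :=
    ⟨{ toFun := fun p => ξ p.2 • Representation.normalizedJacquetGL F (lastBlockLabel 2) (Representation.parabolicIndGL F (lastBlockLabel 2) ((Representation.trivial ℂ (Π a : Bool, GL {i : Fin 2 // lastBlockLabel 2 i = a} F) ℂ).twist (maxParabolicLeviChar F 2 (η * ((unramifiedTwist F (1 / 2) : QuasiChar F).toMonoidHom)⁻¹) (η * ((unramifiedTwist F (1 / 2) : QuasiChar F).toMonoidHom))))) p.1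
       map_one' := by simp only [Prod.snd_one, Prod.fst_one, hξ1, map_one, one_smul]
       map_mul' := fun p q => by
         simp only [Prod.snd_mul, Prod.fst_mul, hξmul, map_mul]
         exact (smul_mul_smul_comm _ _ _ _).symm }, fun p => rfl⟩
  obtain ⟨τ₃, hτ₃⟩ := hτ₃'
  have hg : ∀ p c, jΦ (τ p c) = τ₃ p (jΦ c) := by
    rintro ⟨t, d⟩ c
    refine Representation.Coinvariants.induction_on c fun w => ?_
    have e2 := prodRep_apply_mk W ζ τ hτ₁ hτ₂ t d w
    have e4 : Φ (W (blockDiagonalGL F (lastBlockLabel 2) t) (ζ d w)) = ξ d • (Representation.parabolicIndGL F (lastBlockLabel 2) ((Representation.trivial ℂ (Π a : Bool, GL {i : Fin 2 // lastBlockLabel 2 i = a} F) ℂ).twist (maxParabolicLeviChar F 2 (η * ((unramifiedTwist F (1 / 2) : QuasiChar F).toMonoidHom)⁻¹) (η * ((unramifiedTwist F (1 / 2) : QuasiChar F).toMonoidHom))))) (blockDiagonalGL F (lastBlockLabel 2) t) (Φ w) :=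
      (hΦG _ _).trans ((congrArg _ (hΦD d w)).trans (LinearMap.map_smul _ _ _))
    have hmk3 : jΦ (Representation.Coinvariants.mk (Representation.restrictUnipotentGL F (lastBlockLabel 2) W) (W (blockDiagonalGL F (lastBlockLabel 2) t) (ζ d w))) =
        ξ d • Representation.Coinvariants.mk (Representation.restrictUnipotentGL F (lastBlockLabel 2) (Representation.parabolicIndGL F (lastBlockLabel 2) ((Representation.trivial ℂ (Π a : Bool, GL {i : Fin 2 // lastBlockLabel 2 i = a} F) ℂ).twist (maxParabolicLeviChar F 2 (η * ((unramifiedTwist F (1 / 2) : QuasiChar F).toMonoidHom)⁻¹) (η * ((unramifiedTwist F (1 / 2) : QuasiChar F).toMonoidHom))))))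
          ((Representation.parabolicIndGL F (lastBlockLabel 2) ((Representation.trivial ℂ (Π a : Bool, GL {i : Fin 2 // lastBlockLabel 2 i = a} F) ℂ).twist (maxParabolicLeviChar F 2 (η * ((unramifiedTwist F (1 / 2) : QuasiChar F).toMonoidHom)⁻¹) (η * ((unramifiedTwist F (1 / 2) : QuasiChar F).toMonoidHom))))) (blockDiagonalGL F (lastBlockLabel 2) t) (Φ w)) := by
      rw [hjΦ_mk, e4, LinearMap.map_smul]
    have hmk4 : jΦ (Representation.Coinvariants.mk (Representation.restrictUnipotentGL F (lastBlockLabel 2) W) w) = Representation.Coinvariants.mk (Representation.restrictUnipotentGL F (lastBlockLabel 2) (Representation.parabolicIndGL F (lastBlockLabel 2) ((Representation.trivial ℂ (Π a : Bool, GL {i : Fin 2 // lastBlockLabel 2 i = a} F) ℂ).twist (maxParabolicLeviChar F 2 (η * ((unramifiedTwist F (1 / 2) : QuasiChar F).toMonoidHom)⁻¹) (η * ((unramifiedTwist F (1 / 2) : QuasiChar F).toMonoidHom)))))) (Φ w) := hjΦ_mk w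
    have e5 := Representation.normalizedJacquetGL_mk F (lastBlockLabel 2) (Representation.parabolicIndGL F (lastBlockLabel 2) ((Representation.trivial ℂ (Π a : Bool, GL {i : Fin 2 // lastBlockLabel 2 i = a} F) ℂ).twist (maxParabolicLeviChar F 2 (η * ((unramifiedTwist F (1 / 2) : QuasiChar F).toMonoidHom)⁻¹) (η * ((unramifiedTwist F (1 / 2) : QuasiChar F).toMonoidHom))))) t (Φ w)
    refine (congrArg jΦ e2).trans ?_
    refine (jΦ.map_smul _ _).trans ?_
    rw [hmk3, hmk4, hτ₃, LinearMap.smul_apply, e5]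
    exact smul_comm _ _ _
  have hkey : ∀ (u v : Fˣ →* ℂˣ), (⨅ p, Module.End.maxGenEigenspace (τ₃ p) (((maxParabolicLeviChar F 2 u v p.1 : ℂˣ) : ℂ) * ξ p.2)) =
      ⨅ m, Module.End.maxGenEigenspace (Representation.normalizedJacquetGL F (lastBlockLabel 2) (Representation.parabolicIndGL F (lastBlockLabel 2) ((Representation.trivial ℂ (Π a : Bool, GL {i : Fin 2 // lastBlockLabel 2 i = a} F) ℂ).twist (maxParabolicLeviChar F 2 (η * ((unramifiedTwist F (1 / 2) : QuasiChar F).toMonoidHom)⁻¹) (η * ((unramifiedTwist F (1 / 2) : QuasiChar F).toMonoidHom))))) m) ((maxParabolicLeviChar F 2 u v m : ℂˣ) : ℂ) := by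
    intro u v
    have hp : ∀ p : (Π a : Bool, GL {i : Fin 2 // lastBlockLabel 2 i = a} F) × D, Module.End.maxGenEigenspace (τ₃ p) (((maxParabolicLeviChar F 2 u v p.1 : ℂˣ) : ℂ) * ξ p.2) =
        Module.End.maxGenEigenspace (Representation.normalizedJacquetGL F (lastBlockLabel 2) (Representation.parabolicIndGL F (lastBlockLabel 2) ((Representation.trivial ℂ (Π a : Bool, GL {i : Fin 2 // lastBlockLabel 2 i = a} F) ℂ).twist (maxParabolicLeviChar F 2 (η * ((unramifiedTwist F (1 / 2) : QuasiChar F).toMonoidHom)⁻¹) (η * ((unramifiedTwist F (1 / 2) : QuasiChar F).toMonoidHom))))) p.1) ((maxParabolicLeviChar F 2 u v p.1 : ℂˣ) : ℂ) := by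
      intro p
      rw [hτ₃, maxGenEigenspace_smul_eq _ (hξ0 p.2), mul_comm _ (ξ p.2), inv_mul_cancel_left₀ (hξ0 p.2)]
    refine le_antisymm (le_iInf fun m => ?_) (le_iInf fun p => ?_)
    · rw [← hp (m, 1)]
      exact iInf_le _ _
    · rw [hp p]
      exact iInf_le _ _
  -- (3) NEW: `Φ` is NOT surjective — else the swapped weight `(b ⊠ a) ⊗ ξ` would occur in `τ`
  have hnsurj : ¬ Function.Surjective Φ := by
    intro hs
    have hle : finrank ℂ ↥(⨅ p, Module.End.maxGenEigenspace (τ₃ p) (((maxParabolicLeviChar F 2 (η * ((unramifiedTwist F (1 / 2) : QuasiChar F).toMonoidHom)) (η * ((unramifiedTwist F (1 / 2) : QuasiChar F).toMonoidHom)⁻¹) p.1 : ℂˣ) : ℂ) * ξ p.2)) ≤ finrank ℂ ↥(⨅ p, Module.End.maxGenEigenspace (τ p) (((maxParabolicLeviChar F 2 (η * ((unramifiedTwist F (1 / 2) : QuasiChar F).toMonoidHom)) (η * ((unramifiedTwist F (1 / 2) : QuasiChar F).toMonoidHom)⁻¹) p.1 : ℂˣ) : ℂ) * ξ p.2)) 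:=
      finrank_weightSpace_le_of_surjective τ τ₃ (commute_prodRep hD τ) (commute_prodRep hD τ₃) jΦ hg (hjΦ_surj hs) (fun p => (((maxParabolicLeviChar F 2 (η * ((unramifiedTwist F (1 / 2) : QuasiChar F).toMonoidHom)) (η * ((unramifiedTwist F (1 / 2) : QuasiChar F).toMonoidHom)⁻¹) p.1 : ℂˣ) : ℂ) * ξ p.2))
    have h1 : finrank ℂ ↥(⨅ m, Module.End.maxGenEigenspace (Representation.normalizedJacquetGL F (lastBlockLabel 2) (Representation.parabolicIndGL F (lastBlockLabel 2) ((Representation.trivial ℂ (Π a : Bool, GL {i : Fin 2 // lastBlockLabel 2 i = a} F) ℂ).twist (maxParabolicLeviChar F 2 (η * ((unramifiedTwist F (1 / 2) : QuasiChar F).toMonoidHom)⁻¹) (η * ((unramifiedTwist F (1 / 2) : QuasiChar F).toMonoidHom))))) m) ((maxParabolicLeviChar F 2 (η * ((unramifiedTwist F (1 / 2) : QuasiChar F).toMonoidHom)) (η * ((unramifiedTwist F (1 / 2) : QuasiChar F).toMonoidHom)⁻¹) m : ℂˣ) : ℂ)) = 1 := by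
      rw [finrank_weightSpace_parabolicIndGL (η * ((unramifiedTwist F (1 / 2) : QuasiChar F).toMonoidHom)⁻¹) (η * ((unramifiedTwist F (1 / 2) : QuasiChar F).toMonoidHom)) ha hb (maxParabolicLeviChar F 2 (η * ((unramifiedTwist F (1 / 2) : QuasiChar F).toMonoidHom)) (η * ((unramifiedTwist F (1 / 2) : QuasiChar F).toMonoidHom)⁻¹)), if_neg, if_pos rfl]
      intro h
      exact hab ((maxParabolicLeviChar_two_eq_iff _ _ _ _).1 h).2
    rw [hno, finrank_bot, hkey (η * ((unramifiedTwist F (1 / 2) : QuasiChar F).toMonoidHom)) (η * ((unramifiedTwist F (1 / 2) : QuasiChar F).toMonoidHom)⁻¹), h1] at hle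
    omega
  -- (4) the kernel `K`, the image `N` (a PROPER NON-ZERO subrepresentation of `I₂(a,b)`), the corestriction `Φ_N : W ↠ N`, and `X ⁄ K ≃ N` (prep package)
  have hpack := exists_ker_range_package Φ
  obtain ⟨K, N, ΦN, hKmem, hNmem, hΦN, hΦNsurj, ⟨eKN⟩⟩ := hpack
  have hNbot : N ≠ ⊥ := by
    intro h
    have hm : Φ v₀ ∈ N := (hNmem _).2 ⟨v₀, rfl⟩
    rw [h] at hm
    exact hΦv₀ ((Submodule.mem_bot ℂ).1 hm)
  have hNtop : N ≠ ⊤ := by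
    intro h
    apply hnsurj
    intro w
    have hw : w ∈ N := by rw [h]; trivial
    exact (hNmem w).1 hw
  -- the restricted `D`-action on `K` and smoothness (★ PEEL (3) verbatim)
  have hKζ : ∀ d, ∀ v ∈ K, ζ d v ∈ K := fun d v hv =>
    (hKmem _).2 (by rw [hΦD, (hKmem v).1 hv, smul_zero])
  have hζK' : ∃ ζK : Representation ℂ D K.toSubmodule, ∀ d (v : K.toSubmodule), ((ζK d v : K.toSubmodule) : X) = ζ d (v : X) :=
    ⟨({ toSubmodule := K.toSubmodule, apply_mem_toSubmodule := fun d v hv => hKζ d v hv } : Subrepresentation ζ).toRepresentation, fun d v => rfl⟩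
  obtain ⟨ζK, hζK⟩ := hζK'
  have hWζK : ∀ g d, K.toRepresentation g * ζK d = ζK d * K.toRepresentation g := by
    intro g d
    refine LinearMap.ext fun v => Subtype.ext ?_
    change ((K.toRepresentation g (ζK d v) : K.toSubmodule) : X) = ((ζK d (K.toRepresentation g v) : K.toSubmodule) : X)
    rw [hζK]
    change W g ((ζK d v : K.toSubmodule) : X) = ζ d (W g (v : X))
    rw [hζK, ← Module.End.mul_apply, hWζ, Module.End.mul_apply]
  have hKsm : K.toRepresentation.IsSmooth := hW.toRepresentation K; have hNsm : N.toRepresentation.IsSmooth := hIsm.toRepresentation N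
  -- (5) the Jacquet maps `C(K) → C(X)` (injective), `C(X) → C(N)` (surjective), exact in the middle (★ PEEL (3) pattern)
  have hιK' : ∃ ιK : Representation.IntertwiningMap K.toRepresentation W, ∀ v, ιK v = (v : X) :=
    ⟨⟨K.toSubmodule.subtype, fun g => rfl⟩, fun v => rfl⟩
  obtain ⟨ιK, hιK⟩ := hιK'
  have hιK_inj : Function.Injective ιK := fun a b h => Subtype.ext (by rw [← hιK a, ← hιK b]; exact h)
  have hjK' := exists_jacquetLinearMap K.toRepresentation W hW ιK; obtain ⟨jK, hjK_mk, _hjK_J, hjK_inj, _hjK_surj⟩ := hjK'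
  have hjK_inj' : Function.Injective jK := hjK_inj hιK_inj
  have hjN' := exists_jacquetLinearMap W N.toRepresentation hNsm ΦN
  obtain ⟨jN, hjN_mk, _hjN_J, _hjN_inj, hjN_surj⟩ := hjN'
  have hjN_surj' : Function.Surjective jN := hjN_surj hΦNsurj
  have hΦNU' : ∃ ΦNU : ((Representation.restrictUnipotentGL F (lastBlockLabel 2) W)).IntertwiningMap (Representation.restrictUnipotentGL F (lastBlockLabel 2) N.toRepresentation), ∀ v, ΦNU v = ΦN v :=
    ⟨⟨ΦN.toLinearMap, fun u => ΦN.isIntertwining' _⟩, fun v => rfl⟩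
  obtain ⟨ΦNU, hΦNU⟩ := hΦNU'
  have hΦN0 : ∀ v, ΦN v = 0 ↔ Φ v = 0 := fun v => by
    rw [← hΦN v]
    exact ⟨fun h => by rw [h]; rfl, fun h => Subtype.ext h⟩
  have hexKΦ : Function.Exact ιK.toLinearMap ΦNU := by
    intro v
    constructor
    · intro hv
      rw [hΦNU, hΦN0] at hv
      exact ⟨⟨v, (hKmem v).2 hv⟩, hιK _⟩
    · rintro ⟨w, rfl⟩
      rw [Representation.IntertwiningMap.toLinearMap_apply, hιK, hΦNU, hΦN0]
      exact (hKmem _).1 w.2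
  have hsurjU : Function.Surjective ΦNU := fun w => (hΦNsurj w).imp fun v hv => (hΦNU v).trans hv
  have hjN_mkU : ∀ v, jN (Representation.Coinvariants.mk _ v) = Representation.Coinvariants.mk _ (ΦNU v) := fun v => by rw [hjN_mk, hΦNU]
  have hexact : Function.Exact jK jN :=
    exact_of_mk_comp (Representation.restrictUnipotentGL F (lastBlockLabel 2) K.toRepresentation) (Representation.restrictUnipotentGL F (lastBlockLabel 2) W) (Representation.restrictUnipotentGL F (lastBlockLabel 2) N.toRepresentation)
      ιK.toLinearMap ΦNU hexKΦ hsurjU jK jN hjK_mk hjN_mkU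
  -- (6) the `T₂ × D`-modules on `C(K)` (★ PEEL file 1) and on `C(N)` (`ξ(d) • r_N(t)`), and the equivariance of `jK`, `jN`
  have hτK' := exists_prodRep K.toRepresentation ζK hWζK
  obtain ⟨τK, hτK₁, hτK₂⟩ := hτK'
  have hτN' : ∃ τN : Representation ℂ ((Π a : Bool, GL {i : Fin 2 // lastBlockLabel 2 i = a} F) × D) (Representation.restrictUnipotentGL F (lastBlockLabel 2) N.toRepresentation).Coinvariants,
      ∀ p, τN p = ξ p.2 • Representation.normalizedJacquetGL F (lastBlockLabel 2) N.toRepresentation p.1 :=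
    ⟨{ toFun := fun p => ξ p.2 • Representation.normalizedJacquetGL F (lastBlockLabel 2) N.toRepresentation p.1
       map_one' := by simp only [Prod.snd_one, Prod.fst_one, hξ1, map_one, one_smul]
       map_mul' := fun p q => by
         simp only [Prod.snd_mul, Prod.fst_mul, hξmul, map_mul]
         exact (smul_mul_smul_comm _ _ _ _).symm }, fun p => rfl⟩
  obtain ⟨τN, hτN⟩ := hτN'
  have hf : ∀ p c, jK (τK p c) = τ p (jK c) := by
    rintro ⟨t, d⟩ c
    refine Representation.Coinvariants.induction_on c fun w => ?_
    have e1 := prodRep_apply_mk K.toRepresentation ζK τK hτK₁ hτK₂ t d w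
    have e2 := prodRep_apply_mk W ζ τ hτ₁ hτ₂ t d (w : X)
    have e3 : ((K.toRepresentation (blockDiagonalGL F (lastBlockLabel 2) t) (ζK d w) : K.toSubmodule) : X) = W (blockDiagonalGL F (lastBlockLabel 2) t) (ζ d (w : X)) := by
      rw [← hζK d w]
      rfl
    have hmk1 : jK (Representation.Coinvariants.mk (Representation.restrictUnipotentGL F (lastBlockLabel 2) K.toRepresentation) w) =
        Representation.Coinvariants.mk (Representation.restrictUnipotentGL F (lastBlockLabel 2) W) (w : X) := by
      rw [hjK_mk, hιK]
    have hmk2 : jK (Representation.Coinvariants.mk (Representation.restrictUnipotentGL F (lastBlockLabel 2) K.toRepresentation)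
          (K.toRepresentation (blockDiagonalGL F (lastBlockLabel 2) t) (ζK d w))) =
        Representation.Coinvariants.mk (Representation.restrictUnipotentGL F (lastBlockLabel 2) W) (W (blockDiagonalGL F (lastBlockLabel 2) t) (ζ d (w : X))) := by
      rw [hjK_mk, hιK, e3]
    refine (congrArg jK e1).trans ?_
    refine (jK.map_smul _ _).trans ?_
    rw [hmk2, hmk1]
    exact e2.symm
  have hΦND : ∀ d w, ΦN (ζ d w) = ξ d • ΦN w := fun d w =>
    Subtype.ext (by rw [hΦN, hΦD, Submodule.coe_smul, hΦN])
  have hgN : ∀ p c, jN (τ p c) = τN p (jN c) := by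
    rintro ⟨t, d⟩ c
    refine Representation.Coinvariants.induction_on c fun w => ?_
    have e2 := prodRep_apply_mk W ζ τ hτ₁ hτ₂ t d w
    have e4 : ΦN (W (blockDiagonalGL F (lastBlockLabel 2) t) (ζ d w)) = ξ d • N.toRepresentation (blockDiagonalGL F (lastBlockLabel 2) t) (ΦN w) :=
      (ΦN.isIntertwining _ _ _ _).trans ((congrArg _ (hΦND d w)).trans (LinearMap.map_smul _ _ _))
    have hmk3 : jN (Representation.Coinvariants.mk (Representation.restrictUnipotentGL F (lastBlockLabel 2) W) (W (blockDiagonalGL F (lastBlockLabel 2) t) (ζ d w))) =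
        ξ d • Representation.Coinvariants.mk (Representation.restrictUnipotentGL F (lastBlockLabel 2) N.toRepresentation) (N.toRepresentation (blockDiagonalGL F (lastBlockLabel 2) t) (ΦN w)) := by
      rw [hjN_mk, e4, LinearMap.map_smul]
    have hmk4 : jN (Representation.Coinvariants.mk (Representation.restrictUnipotentGL F (lastBlockLabel 2) W) w) = Representation.Coinvariants.mk (Representation.restrictUnipotentGL F (lastBlockLabel 2) N.toRepresentation) (ΦN w) := hjN_mk w
    have e5 := Representation.normalizedJacquetGL_mk F (lastBlockLabel 2) N.toRepresentation t (ΦN w)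
    refine (congrArg jN e2).trans ?_
    refine (jN.map_smul _ _).trans ?_
    rw [hmk3, hmk4, hτN, LinearMap.smul_apply, e5]
    exact smul_comm _ _ _
  -- (7) NEW: `dim C(N) = 1` (★ S1c) and `T₂ × D` acts on the line `C(N)` by `(a ⊠ b) ⊗ ξ` (the eigenfunctional `E ∘ j_{N ↪ I₂}`, ★ G1 `evalOne`)
  have hN1 := K2E3GL2LinkedJacquetRank.finrank_jacquet_lastBlockLabel_eq_one_of_ne_bot_of_ne_top (η * ((unramifiedTwist F (1 / 2) : QuasiChar F).toMonoidHom)⁻¹) (η * ((unramifiedTwist F (1 / 2) : QuasiChar F).toMonoidHom)) ha hb hNbot hNtop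
  obtain ⟨hNfd, hN1⟩ := hN1
  haveI := hNfd
  have hιN' : ∃ ιN : N.toRepresentation.IntertwiningMap (Representation.parabolicIndGL F (lastBlockLabel 2) ((Representation.trivial ℂ (Π a : Bool, GL {i : Fin 2 // lastBlockLabel 2 i = a} F) ℂ).twist (maxParabolicLeviChar F 2 (η * ((unramifiedTwist F (1 / 2) : QuasiChar F).toMonoidHom)⁻¹) (η * ((unramifiedTwist F (1 / 2) : QuasiChar F).toMonoidHom))))), ∀ w, ιN w = (w : _) :=
    ⟨⟨N.toSubmodule.subtype, fun g => rfl⟩, fun w => rfl⟩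
  obtain ⟨ιN, hιN⟩ := hιN'
  have hjI' := exists_jacquetLinearMap N.toRepresentation (Representation.parabolicIndGL F (lastBlockLabel 2) ((Representation.trivial ℂ (Π a : Bool, GL {i : Fin 2 // lastBlockLabel 2 i = a} F) ℂ).twist (maxParabolicLeviChar F 2 (η * ((unramifiedTwist F (1 / 2) : QuasiChar F).toMonoidHom)⁻¹) (η * ((unramifiedTwist F (1 / 2) : QuasiChar F).toMonoidHom))))) hIsm ιN
  obtain ⟨jI, hjI_mk, hjI_J, _hjI_inj, _hjI_surj⟩ := hjI'
  have hE' := exists_evalOne (F := F) (η * ((unramifiedTwist F (1 / 2) : QuasiChar F).toMonoidHom)⁻¹) (η * ((unramifiedTwist F (1 / 2) : QuasiChar F).toMonoidHom))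
  obtain ⟨E, hE⟩ := hE'
  have hET : ∀ m z, E (jI (Representation.normalizedJacquetGL F (lastBlockLabel 2) N.toRepresentation m z)) = ((maxParabolicLeviChar F 2 (η * ((unramifiedTwist F (1 / 2) : QuasiChar F).toMonoidHom)⁻¹) (η * ((unramifiedTwist F (1 / 2) : QuasiChar F).toMonoidHom)) m : ℂˣ) : ℂ) * E (jI z) := by
    intro m z
    rw [hjI_J]
    exact evalOne_normalizedJacquetGL (η * ((unramifiedTwist F (1 / 2) : QuasiChar F).toMonoidHom)⁻¹) (η * ((unramifiedTwist F (1 / 2) : QuasiChar F).toMonoidHom)) hE m (jI z)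
  have hEτN : ∀ p z, (E ∘ₗ jI) (τN p z) = (((maxParabolicLeviChar F 2 (η * ((unramifiedTwist F (1 / 2) : QuasiChar F).toMonoidHom)⁻¹) (η * ((unramifiedTwist F (1 / 2) : QuasiChar F).toMonoidHom)) p.1 : ℂˣ) : ℂ) * ξ p.2) * (E ∘ₗ jI) z := by
    intro p z
    show E (jI (τN p z)) = _ * E (jI z)
    have h2 : jI (ξ p.2 • Representation.normalizedJacquetGL F (lastBlockLabel 2) N.toRepresentation p.1 z) = ξ p.2 • jI (Representation.normalizedJacquetGL F (lastBlockLabel 2) N.toRepresentation p.1 z) := jI.map_smul _ _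
    have h3 : E (ξ p.2 • jI (Representation.normalizedJacquetGL F (lastBlockLabel 2) N.toRepresentation p.1 z)) = ξ p.2 • E (jI (Representation.normalizedJacquetGL F (lastBlockLabel 2) N.toRepresentation p.1 z)) := E.map_smul _ _
    rw [hτN, LinearMap.smul_apply, h2, h3, hET, smul_eq_mul]
    ring
  have hEv₀ : (E ∘ₗ jI) (jN (Representation.Coinvariants.mk (Representation.restrictUnipotentGL F (lastBlockLabel 2) W) v₀)) = l (Representation.Coinvariants.mk (Representation.restrictUnipotentGL F (lastBlockLabel 2) W) v₀) := by
    show E (jI (jN (Representation.Coinvariants.mk (Representation.restrictUnipotentGL F (lastBlockLabel 2) W) v₀))) = _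
    rw [hjN_mk, hjI_mk, hιN, hΦN]
    exact (hE (Φ v₀)).trans hΦ1
  have hE0 : (E ∘ₗ jI) ≠ 0 := fun h =>
    hz₀ (hEv₀.symm.trans ((LinearMap.congr_fun h _).trans (LinearMap.zero_apply _)))
  have hτNχ : ∀ p z, τN p z = (((maxParabolicLeviChar F 2 (η * ((unramifiedTwist F (1 / 2) : QuasiChar F).toMonoidHom)⁻¹) (η * ((unramifiedTwist F (1 / 2) : QuasiChar F).toMonoidHom)) p.1 : ℂˣ) : ℂ) * ξ p.2) • z :=
    forall_apply_eq_smul_of_finrank_eq_one τN hN1 (fun p => (((maxParabolicLeviChar F 2 (η * ((unramifiedTwist F (1 / 2) : QuasiChar F).toMonoidHom)⁻¹) (η * ((unramifiedTwist F (1 / 2) : QuasiChar F).toMonoidHom)) p.1 : ℂˣ) : ℂ) * ξ p.2)) (E ∘ₗ jI) hE0 hEτN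
  have hwsN_top : (⨅ p, Module.End.maxGenEigenspace (τN p) (((maxParabolicLeviChar F 2 (η * ((unramifiedTwist F (1 / 2) : QuasiChar F).toMonoidHom)⁻¹) (η * ((unramifiedTwist F (1 / 2) : QuasiChar F).toMonoidHom)) p.1 : ℂˣ) : ℂ) * ξ p.2)) = ⊤ := weightSpace_eq_top_of_forall_apply_eq_smul τN (fun p => (((maxParabolicLeviChar F 2 (η * ((unramifiedTwist F (1 / 2) : QuasiChar F).toMonoidHom)⁻¹) (η * ((unramifiedTwist F (1 / 2) : QuasiChar F).toMonoidHom)) p.1 : ℂˣ) : ℂ) * ξ p.2)) hτNχ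
  have hwsN_bot : ∀ χ' : ((Π a : Bool, GL {i : Fin 2 // lastBlockLabel 2 i = a} F) × D) → ℂ, χ' ≠ (fun p => (((maxParabolicLeviChar F 2 (η * ((unramifiedTwist F (1 / 2) : QuasiChar F).toMonoidHom)⁻¹) (η * ((unramifiedTwist F (1 / 2) : QuasiChar F).toMonoidHom)) p.1 : ℂˣ) : ℂ) * ξ p.2)) → (⨅ p, Module.End.maxGenEigenspace (τN p) (χ' p)) = ⊥ :=
    fun χ' hχ' => weightSpace_eq_bot_of_forall_apply_eq_smul_of_ne τN (fun p => (((maxParabolicLeviChar F 2 (η * ((unramifiedTwist F (1 / 2) : QuasiChar F).toMonoidHom)⁻¹) (η * ((unramifiedTwist F (1 / 2) : QuasiChar F).toMonoidHom)) p.1 : ℂˣ) : ℂ) * ξ p.2)) hτNχ hχ'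
  -- (8) additivity of multiplicities (★ E1a) along `0 → C(K) → C(X) → C(N) → 0`
  haveI hfdK : FiniteDimensional ℂ (Representation.restrictUnipotentGL F (lastBlockLabel 2) K.toRepresentation).Coinvariants := Module.Finite.of_injective jK hjK_inj'
  have hadd := fun χ' => finrank_weightSpace_eq_add_of_exact τK τ τN (commute_prodRep hD τ) (commute_prodRep hD τN) jK jN hf hgN hjK_inj' hexact hjN_surj' χ'
  -- (9) NEW: the quotient `X ⁄ K ≃ N ≃ η ∘ det` (prep first isomorphism + ★ S1c `eq_range_of_le_mult` + ★ S1b)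
  have hτN1 : ∀ m, τN (m, 1) = Representation.normalizedJacquetGL F (lastBlockLabel 2) N.toRepresentation m := fun m => by
    have e := hτN (m, 1)
    simp only [hξ1, one_smul] at e
    exact e
  have hrN : ∀ m z, Representation.normalizedJacquetGL F (lastBlockLabel 2) N.toRepresentation m z = ((maxParabolicLeviChar F 2 (η * ((unramifiedTwist F (1 / 2) : QuasiChar F).toMonoidHom)⁻¹) (η * ((unramifiedTwist F (1 / 2) : QuasiChar F).toMonoidHom)) m : ℂˣ) : ℂ) • z := by
    intro m z
    have hs : ((maxParabolicLeviChar F 2 (η * ((unramifiedTwist F (1 / 2) : QuasiChar F).toMonoidHom)⁻¹) (η * ((unramifiedTwist F (1 / 2) : QuasiChar F).toMonoidHom)) m : ℂˣ) : ℂ) * ξ 1 = ((maxParabolicLeviChar F 2 (η * ((unramifiedTwist F (1 / 2) : QuasiChar F).toMonoidHom)⁻¹) (η * ((unramifiedTwist F (1 / 2) : QuasiChar F).toMonoidHom)) m : ℂˣ) : ℂ) := by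
      rw [hξ1, mul_one]
    exact ((LinearMap.congr_fun (hτN1 m) z).symm.trans (hτNχ (m, 1) z)).trans (congrArg (fun c : ℂ => c • z) hs)
  have hwsrN : (⨅ m, Module.End.maxGenEigenspace (Representation.normalizedJacquetGL F (lastBlockLabel 2) N.toRepresentation m) ((maxParabolicLeviChar F 2 (η * ((unramifiedTwist F (1 / 2) : QuasiChar F).toMonoidHom)⁻¹) (η * ((unramifiedTwist F (1 / 2) : QuasiChar F).toMonoidHom)) m : ℂˣ) : ℂ)) = ⊤ :=
    weightSpace_eq_top_of_forall_apply_eq_smul (Representation.normalizedJacquetGL F (lastBlockLabel 2) N.toRepresentation) (fun m => ((maxParabolicLeviChar F 2 (η * ((unramifiedTwist F (1 / 2) : QuasiChar F).toMonoidHom)⁻¹) (η * ((unramifiedTwist F (1 / 2) : QuasiChar F).toMonoidHom)) m : ℂˣ) : ℂ)) hrN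
  have hmultN : 1 ≤ finrank ℂ ↥(⨅ m, Module.End.maxGenEigenspace (Representation.normalizedJacquetGL F (id : Fin 2 → Fin 2) N.toRepresentation m) ((((∏ a : Fin 2, ((![η * ((unramifiedTwist F (1 / 2) : QuasiChar F).toMonoidHom)⁻¹, η * ((unramifiedTwist F (1 / 2) : QuasiChar F).toMonoidHom)] : Fin 2 → (Fˣ →* ℂˣ)) a).comp (Matrix.GeneralLinearGroup.det.comp (Pi.evalMonoidHom (fun a : Fin 2 => GL {i : Fin 2 // (id : Fin 2 → Fin 2) i = a} F) a))) m : ℂˣ) : ℂ))) := by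
    rw [K2E3GL2JacquetRelabel.finrank_weightSpace_id_eq_lastBlockLabel_two N.toRepresentation (η * ((unramifiedTwist F (1 / 2) : QuasiChar F).toMonoidHom)⁻¹) (η * ((unramifiedTwist F (1 / 2) : QuasiChar F).toMonoidHom)), hwsrN, finrank_top, hN1]
  have hΦL' := K2E3GL2LinkedStructure.exists_injective_intertwiningMap_twist_det_principalSeries_two η hη
  obtain ⟨ΦL, hΦL⟩ := hΦL'
  have hNL : N = ΦL.range := K2E3GL2LinkedJacquetRank.eq_range_of_le_mult η hη ΦL hΦL N hNtop hmultN
  have heL := nonempty_equiv_range_of_injective ΦL hΦL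
  obtain ⟨eL⟩ := heL
  have heN : Nonempty (N.toRepresentation.Equiv ((Representation.trivial ℂ (GL (Fin 2) F) ℂ).twist (η.comp (Matrix.GeneralLinearGroup.det : GL (Fin 2) F →* Fˣ)))) := by
    rw [hNL]
    exact ⟨eL.symm⟩
  obtain ⟨eN⟩ := heN
  refine ⟨K, ζK, τK, hζK, hWζK, hKsm, hτK₁, hτK₂, hfdK, ?_, ?_, ?_, ⟨eKN.trans eN⟩⟩
  · -- `finrank C(K) + 1 = finrank C(X)`
    have hrn := LinearMap.finrank_range_add_finrank_ker jN
    rw [LinearMap.range_eq_top.2 hjN_surj', finrank_top, hN1] at hrn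
    have hker : finrank ℂ ↥(LinearMap.ker jN) = finrank ℂ (Representation.restrictUnipotentGL F (lastBlockLabel 2) K.toRepresentation).Coinvariants := by
      rw [LinearMap.exact_iff.1 hexact]
      exact (LinearEquiv.finrank_eq (LinearEquiv.ofInjective jK hjK_inj')).symm
    omega
  · rw [hadd, hwsN_top, finrank_top, hN1]
  · intro χ' hχ'
    rw [hadd χ', hwsN_bot χ' hχ', finrank_bot, add_zero]

end Peel

end Summit.HodgeConjecture.HodgeConjecture.Cruxes.H413.K2E3GL3PeelLinked

end
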